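import Literature.NumberTheory.GelbartRogawski1991.LocalDoubledGaloisConjSiegel
import Literature.NumberTheory.Automorphic.UnitaryGroupInertPlaceHyperbolicBasis
import Literature.NumberTheory.Automorphic.AdelicVectorHeightGalois
import HarnessLib

/-!
# `g ↦ ḡ` on the doubled unitary group at a NON-SPLIT place: `det_Δ ḡ = σ_w(det_Δ g)` and `χ_v(det_Δ ḡ) = (χ_v ∘ σ_w)(det_Δ g)`

Topic `NumberTheory/GelbartRogawski1991`; namespace `Literature.NumberTheory.GelbartRogawski1991.UnitaryDualPair.LocalSplitting`.  KERNEL ONLY: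
theorems; no definition, no named fact, no `sorry`.  Cell `hodgecm-mathlib` (D-0151), programme P5 (crux HLiu418 = stmt-HodgeConjecture-24832), piece
**P1b** of the road card `F0/P5/A-p18/g23/ROAD-L4if-v2.A-p18g23.md` §4 (A-p18 (g23), 2026-08-31), sequel of ★ P1a `LocalDoubledGaloisConjSiegel`
(p834936): the Siegel-parabolic SCALAR of the `χ`-normalised doubled CM section read at `p̄` — the input with which ★
`eq_of_parabolic_toRep_conj_eq` pins `Σ_χ ∘ bar` — at the places the letter L4if is about (`v` non-split in `E/F`: ONE place `w ∣ v`, fixed by `c`).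

THE MATHEMATICS ([Kudla1994, §3]; [HarrisKudlaSweet1996, §1 (1.15)–(1.16)]).  At a place `w ∣ v` with `c • w = w`, `c` induces the automorphism
`σ_w = galAdicCompletionMap c _ : E_w →+* E_w` (an involution, ★ `galAdicCompletionMap_galAdicCompletionMap_of_smul_eq`), `(c ⊗ 1)(y)_w = σ_w(y_w)`
(★ `conjLocal_apply_eq_of_smul_eq`), and there is only one place above `v` (★ `PlacesOver.eq_of_smul_eq`).  Hence, from P1a's
`det_Δ(p̄)_w = c_*(det_Δ(p)_{c⁻¹w})`:
* `detDelta_localPiGalConj_of_smul_eq` — **`det_Δ(p̄)_w = σ_w(det_Δ(p)_w)`**;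
* `isUnit_detDelta_localPiGalConj_iff` — `det_Δ(p̄)_w` is a unit iff `det_Δ(p)_w` is;
* `chiDet_localPiGalConj_of_forall_smul_eq` — **`χ_v(det_Δ p̄) = (χ ∘ σ)_v(det_Δ p)`**: `chiDet χv p̄ = chiDet (fun w => χv w ∘ σ_w) p` for EVERY family of
  characters `χv w : E_wˣ →* ℂˣ` (★ `chiDet`).  For the family `χv w = (χ_w)⁻¹` of a Hecke character `χ` (the normalisation of ★
  `localSplittingDatumCM`), `χ_w ∘ σ_w` is the local component of the conjugate character `χᶜ` — so the scalar of `Σ_χ` at `p̄` is the scalar of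
  `Σ_{χᶜ}` at `p` (the modulus factor `∏‖det_Δ p_w‖^{1/2}` is `σ_w`-invariant), which is the statement the P1 file feeds to Kudla rigidity.
Nothing of the cited sources is asserted; HC_CM is proved only modulo the printed citations until rung 0 closes.

## References
* [Kudla1994] S. Kudla, Israel J. Math. 87 (1994), §3 (`x(p) = det_Δ p` on the Siegel parabolic; Thm. 3.1).
* [HarrisKudlaSweet1996] M. Harris, S. Kudla, W. Sweet, J. AMS 9 (1996), §1 (1.15)–(1.16) (the character `χ(x(p))` of the normalised splitting).
* [PlatonovRapinchuk1994] V. Platonov, A. Rapinchuk, *Algebraic Groups and Number Theory* (1994), §5.1 (local structure at a non-split place).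
-/

set_option autoImplicit false

noncomputable section

open NumberField IsDedekindDomain Matrix
open Literature.NumberTheory.Automorphic Literature.NumberTheory.Automorphic.UnitaryGroup

namespace Literature.NumberTheory.GelbartRogawski1991.UnitaryDualPair.LocalSplitting

variable (F : Type) [Field F] [NumberField F] (E : Type) [Field E] [NumberField E] [Algebra F E]
  [Algebra.IsQuadraticExtension F E] (c : E ≃ₐ[F] E) (hc : c ≠ 1)
  (v : HeightOneSpectrum (𝓞 F)) (n : ℕ) {T₀ : Matrix (Fin n) (Fin n) F}
  {JD : Matrix (Fin (n + n)) (Fin (n + n)) E} (hJD : JD = (gramD F n T₀).map (algebraMap F E))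

include hc

omit [Algebra.IsQuadraticExtension F E] in
/-- At a place `w` fixed by `c` there is one place above `v`: `σ`-transport read from ANY `w₁` with `c • w₁ = w` is `σ_w` (private copy of ★
`UnitaryGroup.galAdicCompletionMap_apply_eq_of_smul_eq`, kept import-light). [cite: PlatonovRapinchuk1994, §5.1] -/
private theorem galAdicCompletionMap_apply_eq_of_smul_eq' [Algebra.IsQuadraticExtension F E] (w : PlacesOver E v) (hw : c • w.1 = w.1)
    (w₁ : PlacesOver E v) (h₁ : c • w₁.1 = w.1) (y : LocalRing E v) :
    galAdicCompletionMap (L := E) c h₁ (y w₁) = galAdicCompletionMap (L := E) c hw (y w) := by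
  obtain rfl : w₁ = w := PlacesOver.eq_of_smul_eq c hc w hw w₁
  rfl

/-- **`det_Δ(p̄)_w = σ_w(det_Δ(p)_w)`** at a place `w ∣ v` fixed by `c` (non-split `v`). [cite: Kudla1994, §3] [cite: PlatonovRapinchuk1994, §5.1] -/
theorem detDelta_localPiGalConj_of_smul_eq (w : PlacesOver E v) (hw : c • w.1 = w.1) (p : UnitaryGroup.localPi E c (n + n) JD v) :
    detDelta F E c v n w (localPiGalConj E c (n + n) v hJD p) = galAdicCompletionMap (L := E) c hw (detDelta F E c v n w p) := by
  rw [detDelta_localPiGalConj F E c v n hJD p w]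
  exact galAdicCompletionMap_apply_eq_of_smul_eq' F E c hc v w hw (PlacesOver.galInv c w) (smul_inv_smul c w.1)
    (fun w' : PlacesOver E v => detDelta F E c v n w' p)

/-- `det_Δ(p̄)_w` is a unit iff `det_Δ(p)_w` is (`σ_w` is an involutive ring homomorphism). [cite: Kudla1994, §3] -/
theorem isUnit_detDelta_localPiGalConj_iff (w : PlacesOver E v) (hw : c • w.1 = w.1) (p : UnitaryGroup.localPi E c (n + n) JD v) :
    IsUnit (detDelta F E c v n w (localPiGalConj E c (n + n) v hJD p)) ↔ IsUnit (detDelta F E c v n w p) := by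
  rw [detDelta_localPiGalConj_of_smul_eq F E c hc v n hJD w hw p]
  refine ⟨fun h => ?_, fun h => h.map _⟩
  have h' := h.map (galAdicCompletionMap (L := E) c hw)
  rwa [galAdicCompletionMap_galAdicCompletionMap_of_smul_eq c w hc hw] at h'

/-- **`χ_v(det_Δ p̄) = (χ ∘ σ)_v(det_Δ p)`** at a non-split `v` (every `w ∣ v` fixed by `c`): `chiDet χv p̄ = chiDet (fun w => χv w ∘ σ_w) p` for every
family of characters `χv w : E_wˣ →* ℂˣ`.  For `χv w = χ_w⁻¹` (the `P_Δ`-normalisation of ★ `localSplittingDatumCM`), `χ_w ∘ σ_w` is the local component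
of the conjugate Hecke character — the scalar of `Σ_χ` at `p̄` is that of `Σ_{χᶜ}` at `p`. [cite: HarrisKudlaSweet1996, §1 (1.15)–(1.16)] [cite: Kudla1994, §3] -/
theorem chiDet_localPiGalConj_of_forall_smul_eq (hns : ∀ w : PlacesOver E v, c • w.1 = w.1)
    (χv : ∀ w : PlacesOver E v, (w.1.adicCompletion E)ˣ →* ℂˣ) (p : UnitaryGroup.localPi E c (n + n) JD v) :
    chiDet F E c v n χv (localPiGalConj E c (n + n) v hJD p) =
      chiDet F E c v n (fun w => (χv w).comp (Units.map (galAdicCompletionMap (L := E) c (hns w) : w.1.adicCompletion E →* w.1.adicCompletion E)))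
        p := by
  classical
  unfold chiDet
  refine Finset.prod_congr rfl fun w _ => ?_
  have e := detDelta_localPiGalConj_of_smul_eq F E c hc v n hJD w (hns w) p
  by_cases hu : IsUnit (detDelta F E c v n w p)
  · have hu' : IsUnit (detDelta F E c v n w (localPiGalConj E c (n + n) v hJD p)) :=
      (isUnit_detDelta_localPiGalConj_iff F E c hc v n hJD w (hns w) p).2 hu
    have hunit : hu'.unit = Units.map (galAdicCompletionMap (L := E) c (hns w) : w.1.adicCompletion E →* w.1.adicCompletion E) hu.unit :=
      Units.ext (by rw [IsUnit.unit_spec, Units.coe_map, MonoidHom.coe_coe, IsUnit.unit_spec, e])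
    rw [dif_pos hu', dif_pos hu, hunit, MonoidHom.comp_apply]
  · have hu' : ¬ IsUnit (detDelta F E c v n w (localPiGalConj E c (n + n) v hJD p)) :=
      fun h => hu ((isUnit_detDelta_localPiGalConj_iff F E c hc v n hJD w (hns w) p).1 h)
    rw [dif_neg hu', dif_neg hu]

/-- The modulus factor `∏_w ‖det_Δ p_w‖` is unchanged under `bar` at a non-split `v` (`σ_w` is an isometry of `E_w`).
[cite: HarrisKudlaSweet1996, §1 (1.16)] [cite: PlatonovRapinchuk1994, §5.1] -/
theorem norm_detDelta_localPiGalConj_of_smul_eq (w : PlacesOver E v) (hw : c • w.1 = w.1) (p : UnitaryGroup.localPi E c (n + n) JD v) :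
    ‖detDelta F E c v n w (localPiGalConj E c (n + n) v hJD p)‖ = ‖detDelta F E c v n w p‖ := by
  rw [detDelta_localPiGalConj_of_smul_eq F E c hc v n hJD w hw p]
  exact norm_galAdicCompletionMap c hw _

end Literature.NumberTheory.GelbartRogawski1991.UnitaryDualPair.LocalSplitting

end
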